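import Summits.CriticalPhenomena.CardyFormulaZ2.Theorems.CardyComplexConeParafermionToSLESixFamiliesDiamondBIdLocal
import HarnessLib

/-!
# Line `potential-darboux-picard-diamond`, stub S4v (`stub_boundaryIdentification`): boundary behaviour of `H` on the real axis and at infinity

Helper file of the stub `stub_boundaryIdentification` of crux `ParafermionToSLESixFamilies` (stmt-CriticalPhenomena-11389).
With `φ : ℍ → D` a chordal uniformizer of the marked diamond, `P = Ψ ∘ cayley` its Carathéodory extension and
`H(u) = (G′(φ u))³ · u · φ′(u)`, this file establishes the three boundary facts of step (v):
* `H_bound_near_break`: `H` is bounded near every real point sent by `P` to a break point of the boundary chain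
  (`localBreakBound` for `p = φ(x + ·)`; at the mark `a`, `x = 0` supplies the factor `u`);
* `H_bound_near_infty` (registered helper): `H` is bounded near `∞` (`localBreakBound` for `p = φ(-1/·)` at the mark
  `b = P(∞)`, through `cayley(-1/τ) = -cayley τ`);
* `H_sq_tendsto_regular`: at a real point sent into an open piece `j`, `H²` has the limit `ρ · κ²` within `ℍ` with
  `ρ > 0` and `κ² = (d_0³/u_0²)²` the common squared boundary phase (Schwarz reflection of `φ` and `G ∘ φ` across the
  piece, `reflectedGerm`; `κ_j² = κ_0²`, `kappa_sq_eq`).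
-/

noncomputable section

namespace Summit.CriticalPhenomena.CardyFormulaZ2.Cruxes.ParafermionToSLESixFamilies.PotentialDarbouxPicardDiamond

open scoped Topology Real ComplexConjugate
open Filter Set Metric Complex
open UpperHalfPlane (upperHalfPlaneSet isOpen_upperHalfPlaneSet)
open Literature.Probability.RandomPlanarGeometry

/-- A uniform-continuity radius: points of the closed half-plane within `r` of `x₀` are sent by a map continuous on the
closed half-plane to within `ε` of its value at `x₀`. -/
theorem exists_radius_of_continuousOn {Q : ℂ → ℂ} (hQ : ContinuousOn Q {u : ℂ | 0 ≤ u.im}) {x₀ : ℂ} (hx₀ : 0 ≤ x₀.im)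
    {ε : ℝ} (hε : 0 < ε) : ∃ r : ℝ, 0 < r ∧ ∀ w : ℂ, 0 ≤ w.im → dist w x₀ < r → dist (Q w) (Q x₀) < ε := by
  obtain ⟨r, hr, h⟩ := Metric.continuousWithinAt_iff.1 (hQ x₀ hx₀) ε hε
  exact ⟨r, hr, fun w hw hdist => h hw hdist⟩

/-- The norm of `H`. -/
theorem norm_H (a u b : ℂ) : ‖a ^ 3 * u * b‖ = ‖a‖ ^ 3 * ‖u‖ * ‖b‖ := by
  rw [norm_mul, norm_mul, norm_pow]

/-- **`H` is bounded near a real point sent to a break point.** -/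
theorem H_bound_near_break (D : DobrushinDomain) (N : ℕ) (ℓ : ℝ → ℂ) (t : ℕ → ℝ) (G : ℂ → ℂ) (d : ℕ → ℂ) (K : Set ℂ)
    (hN : 0 < N) (hper : ∀ s : ℝ, ℓ (s + 2 * Real.pi) = ℓ s) (hrange : Set.range ℓ = frontier D.carrier)
    (hinj : Set.InjOn ℓ (Set.Ico 0 (2 * Real.pi))) (ht0 : t 0 = 0) (htlt : ∀ j, t j < t (j + 1))
    (htper : ∀ j, t (j + N) = t j + 2 * Real.pi) (hseg : ∀ j, IsBdrySegment D (ℓ (t j)) (ℓ (t (j + 1))))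
    (haff : ∀ (j : ℕ) (s : ℝ), t j ≤ s → s ≤ t (j + 1) →
      ℓ s = ℓ (t j) + (((s - t j) / (t (j + 1) - t j) : ℝ) : ℂ) * (ℓ (t (j + 1)) - ℓ (t j)))
    (hd0 : ‖d 0‖ = 1)
    (hd : ∀ j, d (j + 1) = d j * Complex.exp ((((2 / 3 : ℝ) * ((ℓ (t (j + 2)) - ℓ (t (j + 1))) /
      (ℓ (t (j + 1)) - ℓ (t j))).arg + Real.pi / 3 * markInd D (ℓ (t (j + 1)))) : ℝ) * Complex.I))
    (harg : ∀ j, ((ℓ (t (j + 2)) - ℓ (t (j + 1))) / (ℓ (t (j + 1)) - ℓ (t j))).arg = 0 ∨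
      ((ℓ (t (j + 2)) - ℓ (t (j + 1))) / (ℓ (t (j + 1)) - ℓ (t j))).arg = Real.pi / 2)
    (hθcases : ∀ j, (2 / 3 : ℝ) * ((ℓ (t (j + 2)) - ℓ (t (j + 1))) / (ℓ (t (j + 1)) - ℓ (t j))).arg +
      Real.pi / 3 * markInd D (ℓ (t (j + 1))) = Real.pi / 3 ∨ (2 / 3 : ℝ) * ((ℓ (t (j + 2)) - ℓ (t (j + 1))) /
      (ℓ (t (j + 1)) - ℓ (t j))).arg + Real.pi / 3 * markInd D (ℓ (t (j + 1))) = 2 * Real.pi / 3)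
    (hGc : ContinuousOn G (closure D.carrier)) (hGd : DifferentiableOn ℂ G D.carrier) (hGim : G '' D.carrier = interior K)
    (hstrict : ∀ w₀ ∈ interior K, ∀ j : ℕ, 0 < ((w₀ - G (ℓ (t j))) * (starRingEnd ℂ) (d j)).im)
    (hmono : ∀ (j : ℕ) (s s' : ℝ), t j ≤ s → s ≤ s' → s' ≤ t (j + 1) → ∃ r : ℝ, 0 ≤ r ∧ G (ℓ s') - G (ℓ s) = r * d j)
    (φ : ConformalEquiv upperHalfPlaneSet D.carrier) (Ψ : ℂ → ℂ) (hΨc : ContinuousOn Ψ (closedBall 0 1))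
    (hΨi : InjOn Ψ (closedBall 0 1)) (hΨcl : MapsTo Ψ (closedBall 0 1) (closure D.carrier))
    (hΨfr : MapsTo Ψ (sphere 0 1) (frontier D.carrier)) (hφΨ : ∀ u ∈ upperHalfPlaneSet, φ u = Ψ (cayleyFun u))
    (hΨ0 : Ψ (cayleyFun 0) = D.pt 0) (hΨ1 : Ψ 1 = D.pt 1)
    (x : ℝ) (i : ℕ) (hi1 : 1 ≤ i) (hiN : i ≤ N) (hx : Ψ (cayleyFun x) = ℓ (t i)) :
    ∃ C ρ : ℝ, 0 < ρ ∧ ∀ u ∈ upperHalfPlaneSet, dist u x < ρ → ‖deriv G (φ u) ^ 3 * u * deriv φ u‖ ≤ C := by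
  obtain ⟨j, rfl⟩ : ∃ j, i = j + 1 := ⟨i - 1, by omega⟩
  -- the neighbourhood of the break point and the radius
  obtain ⟨ρ₀, hρ₀, hnear⟩ := frontier_near_break D N ℓ t hN hper hrange hinj ht0 htlt htper haff (j + 1) hi1 hiN
  rw [Nat.add_sub_cancel] at hnear
  set P : ℂ → ℂ := fun u => Ψ (cayleyFun u) with hP
  have hPc : ContinuousOn P {u : ℂ | 0 ≤ u.im} := continuousOn_extP hΨc
  obtain ⟨r, hr, hrad⟩ := exists_radius_of_continuousOn hPc (x₀ := (x : ℂ)) (by simp) hρ₀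
  -- the hypotheses of the local bound for `p = φ (x + ·)`
  have himadd : ∀ z : ℂ, ((x : ℂ) + z).im = z.im := fun z => by simp
  obtain ⟨C, r', hC, hr', hr'r, hbound⟩ := localBreakBound D ℓ t G d K htlt hseg haff hd0 hd harg hθcases hGc hGd hGim
    hstrict hmono j r (fun z => φ ((x : ℂ) + z)) (fun z => P ((x : ℂ) + z)) hr
    (hPc.comp (continuous_const_add _).continuousOn fun z hz => by simpa [himadd] using hz.2)
    (φ.differentiableOn.comp (differentiableOn_id.const_add _) fun z hz => by
      show 0 < ((x : ℂ) + z).im; rw [himadd]; exact hz.2)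
    (fun z _ hzim => (hφΨ _ (by show 0 < ((x : ℂ) + z).im; rw [himadd]; exact hzim)).symm)
    (by simp only [hP, add_zero]; exact hx)
    (fun z _ hzim => φ.mapsTo (by show 0 < ((x : ℂ) + z).im; rw [himadd]; exact hzim))
    (fun z _ hzim => hΨcl (cayleyFun_mem_closedBall (by rw [himadd]; exact hzim)))
    (by
      intro z hz hzim
      have hfr : P ((x : ℂ) + z) ∈ frontier D.carrier := hΨfr (cayleyFun_mem_sphere (by rw [himadd]; exact hzim))
      have hdist : dist (P ((x : ℂ) + z)) (ℓ (t (j + 1))) < ρ₀ := by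
        rw [← hx]
        exact hrad _ (by rw [himadd]; exact hzim.ge) (by simpa [dist_eq_norm] using mem_ball_zero_iff.1 hz)
      exact hnear _ hfr hdist)
  -- the bound on `H`
  refine ⟨max C (C * (|x| + r')), r', hr', fun u hu hdist => ?_⟩
  set ζ : ℂ := u - x with hζ
  have hxζ : (x : ℂ) + ζ = u := by rw [hζ]; ring
  have hζmem : ζ ∈ ball (0:ℂ) r' := by rw [mem_ball_zero_iff, hζ, ← dist_eq_norm]; exact hdist
  have hζim : 0 < ζ.im := by rw [hζ, sub_im, ofReal_im, sub_zero]; exact hu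
  obtain ⟨h1, h2⟩ := hbound ζ hζmem hζim
  have hder : deriv (fun z => φ ((x : ℂ) + z)) ζ = deriv φ u := by rw [deriv_comp_const_add, hxζ]
  simp only [hxζ, hder] at h1 h2
  rw [norm_H]
  rcases markInd_eq_zero_or_one D (ℓ (t (j + 1))) with hm0 | hm1
  · have hb := h2 hm0
    have hun : ‖u‖ ≤ |x| + r' := by
      have : ‖u‖ ≤ ‖(x : ℂ)‖ + ‖ζ‖ := by rw [← hxζ]; exact norm_add_le _ _
      rw [norm_real, Real.norm_eq_abs] at this
      linarith [mem_ball_zero_iff.1 hζmem]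
    calc ‖deriv G (φ u)‖ ^ 3 * ‖u‖ * ‖deriv φ u‖ = ‖deriv G (φ u)‖ ^ 3 * ‖deriv φ u‖ * ‖u‖ := by ring
      _ ≤ C * (|x| + r') := by gcongr
      _ ≤ max C (C * (|x| + r')) := le_max_right _ _
  · -- the break point is a mark, hence `a`, hence `x = 0` and `u = ζ`
    have hmark : ℓ (t (j + 1)) = D.pt 0 ∨ ℓ (t (j + 1)) = D.pt 1 := by
      by_contra h
      simp only [markInd, if_neg h] at hm1
      exact zero_ne_one hm1
    have ha : ℓ (t (j + 1)) = D.pt 0 := by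
      rcases hmark with h | h
      · exact h
      · exfalso; rw [← hx, ← hΨ1] at h; exact extP_ne_pt_one hΨi (by simp) h
    have hx0 : (x : ℂ) = 0 := by
      have h : P x = P 0 := by simp only [hP]; rw [hx, ha, hΨ0]
      exact injOn_extP hΨi (by simp) (by simp) h
    have huζ : u = ζ := by rw [hζ, hx0, sub_zero]
    rw [← huζ] at h1
    exact h1.trans (le_max_left _ _)

/-- **`H` is bounded near infinity** (registered helper): for a chordal uniformizer `φ` with Carathéodory extension
`Ψ ∘ cayley` (`Ψ(cayley 0) = a`, `Ψ 1 = b`), the function `H(u) = (G′(φ u))³ · u · φ′(u)` is bounded on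
`{u ∈ ℍ : ‖u‖ > R}` for some `R` — the local exponent count at the mark `b = P(∞)` applied to `φ(-1/·)`. -/
theorem H_bound_near_infty : ∀ (D : DobrushinDomain) (N : ℕ) (ℓ : ℝ → ℂ) (t : ℕ → ℝ) (G : ℂ → ℂ) (d : ℕ → ℂ) (K : Set ℂ), 0 < N → (∀ s : ℝ, ℓ (s + 2 * Real.pi) = ℓ s) → Set.range ℓ = frontier D.carrier → Set.InjOn ℓ (Set.Ico 0 (2 * Real.pi)) → t 0 = 0 → (∀ j, t j < t (j + 1)) → (∀ j, t (j + N) = t j + 2 * Real.pi) → (∀ j, IsBdrySegment D (ℓ (t j)) (ℓ (t (j + 1)))) → (∀ (j : ℕ) (s : ℝ), t j ≤ s → s ≤ t (j + 1) → ℓ s = ℓ (t j) + (((s - t j) / (t (j + 1) - t j) : ℝ) : ℂ) * (ℓ (t (j + 1)) - ℓ (t j))) → ‖d 0‖ = 1 → (∀ j, d (j + 1) = d j * Complex.exp ((((2 / 3 : ℝ) * ((ℓ (t (j + 2)) - ℓ (t (j + 1))) / (ℓ (t (j + 1)) - ℓ (t j))).arg + Real.pi / 3 * markInd D (ℓ (t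 (j + 1)))) : ℝ) * Complex.I)) → (∀ j, ((ℓ (t (j + 2)) - ℓ (t (j + 1))) / (ℓ (t (j + 1)) - ℓ (t j))).arg = 0 ∨ ((ℓ (t (j + 2)) - ℓ (t (j + 1))) / (ℓ (t (j + 1)) - ℓ (t j))).arg = Real.pi / 2) → (∀ j, (2 / 3 : ℝ) * ((ℓ (t (j + 2)) - ℓ (t (j + 1))) / (ℓ (t (j + 1)) - ℓ (t j))).arg + Real.pi / 3 * markInd D (ℓ (t (j + 1))) = Real.pi / 3 ∨ (2 / 3 : ℝ) * ((ℓ (t (j + 2)) - ℓ (t (j + 1))) / (ℓ (t (j + 1)) - ℓ (t j))).arg + Real.pi / 3 * markInd D (ℓ (t (j + 1))) = 2 * Real.pi / 3) → ContinuousOn G (closure D.carrier) → DifferentiableOn ℂ G D.carrier → G '' D.carrier = interior K → (∀ w₀ ∈ interior K, ∀ j : ℕ, 0 < ((w₀ - G (ℓ (t j))) * (starRingEnd ℂ) (d j)).im) → (∀ (j : ℕ) (s s' : ℝ), t j ≤ s → s ≤ s' → s' ≤ t (j + 1) → ∃ r : ℝ, 0 ≤ r ∧ G (ℓ s') - G (ℓ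 s) = r * d j) → ∀ (φ : ConformalEquiv upperHalfPlaneSet D.carrier) (Ψ : ℂ → ℂ), ContinuousOn Ψ (Metric.closedBall 0 1) → Set.InjOn Ψ (Metric.closedBall 0 1) → Set.MapsTo Ψ (Metric.closedBall 0 1) (closure D.carrier) → Set.MapsTo Ψ (Metric.sphere 0 1) (frontier D.carrier) → (∀ u ∈ upperHalfPlaneSet, φ u = Ψ (cayleyFun u)) → Ψ (cayleyFun 0) = D.pt 0 → Ψ 1 = D.pt 1 → ∃ C R : ℝ, 0 < R ∧ ∀ u ∈ upperHalfPlaneSet, R < ‖u‖ → ‖deriv G (φ u) ^ 3 * u * deriv φ u‖ ≤ C := by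
  intro D N ℓ t G d K hN hper hrange hinj ht0 htlt htper hseg haff hd0 hd harg hθcases hGc hGd hGim hstrict hmono φ Ψ hΨc
    hΨi hΨcl hΨfr hφΨ _ hΨ1
  -- `b` is a break point `ℓ (t (j+1))`
  obtain ⟨i, hi1, hiN, hb⟩ := exists_break_eq_pt hN hper hrange ht0 htper hseg haff (1 : Fin 2)
  obtain ⟨j, rfl⟩ : ∃ j, i = j + 1 := ⟨i - 1, by omega⟩
  obtain ⟨ρ₀, hρ₀, hnear⟩ := frontier_near_break D N ℓ t hN hper hrange hinj ht0 htlt htper haff (j + 1) hi1 hiN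
  rw [Nat.add_sub_cancel] at hnear
  set P₁ : ℂ → ℂ := fun u => Ψ (-cayleyFun u) with hP₁
  have hP₁c : ContinuousOn P₁ {u : ℂ | 0 ≤ u.im} := continuousOn_extP₁ hΨc
  have hC0 : cayleyFun 0 = -1 := by rw [cayleyFun_apply, zero_sub, zero_add, neg_div, div_self I_ne_zero]
  have hP₁0 : P₁ 0 = ℓ (t (j + 1)) := by simp only [hP₁]; rw [hC0, neg_neg, hΨ1, hb]
  obtain ⟨r, hr, hrad⟩ := exists_radius_of_continuousOn hP₁c (x₀ := (0 : ℂ)) (by simp) hρ₀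
  -- the hypotheses of the local bound for `p = φ (-1/·)`
  have hinvH : ∀ z : ℂ, 0 < z.im → -z⁻¹ ∈ upperHalfPlaneSet := fun z hz => (H_inv_eq φ (G := G) hz).1
  obtain ⟨C, r', -, hr', -, hbound⟩ := localBreakBound D ℓ t G d K htlt hseg haff hd0 hd harg hθcases hGc hGd hGim
    hstrict hmono j r (fun z => φ (-z⁻¹)) P₁ hr (hP₁c.mono inter_subset_right)
    (φ.differentiableOn.comp (differentiableOn_inv.neg.mono fun z hz => by
        show z ≠ 0; rintro rfl; exact absurd hz.2 (by simp)) fun z hz => hinvH z hz.2)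
    (by
      intro z _ hzim
      have hz0 : z ≠ 0 := by rintro rfl; simp at hzim
      simp only [hP₁]
      rw [← cayleyFun_neg_inv hzim.le hz0, ← hφΨ _ (hinvH z hzim)])
    hP₁0 (fun z _ hzim => φ.mapsTo (hinvH z hzim)) (fun z _ hzim => hΨcl (neg_cayleyFun_mem_closedBall hzim))
    (by
      intro z hz hzim
      have hfr : P₁ z ∈ frontier D.carrier := by
        refine hΨfr ?_
        rw [mem_sphere_zero_iff_norm, norm_neg, ← mem_sphere_zero_iff_norm]
        exact cayleyFun_mem_sphere hzim
      have hdist : dist (P₁ z) (ℓ (t (j + 1))) < ρ₀ := by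
        rw [← hP₁0]
        exact hrad _ hzim.ge (by simpa [dist_eq_norm] using mem_ball_zero_iff.1 hz)
      exact hnear _ hfr hdist)
  -- the bound on `H` for `‖u‖ > 1/r'`
  refine ⟨C, 1 / r', by positivity, fun u hu hR => ?_⟩
  have hu0 : u ≠ 0 := by rintro rfl; exact absurd hu (by simp [upperHalfPlaneSet])
  have hun : 0 < ‖u‖ := norm_pos_iff.2 hu0
  set τ : ℂ := -u⁻¹ with hτ
  have hτH : τ ∈ upperHalfPlaneSet := hinvH u hu
  have hτu : -τ⁻¹ = u := by rw [hτ, inv_neg, inv_inv, neg_neg]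
  have hτmem : τ ∈ ball (0:ℂ) r' := by
    rw [mem_ball_zero_iff, hτ, norm_neg, norm_inv, inv_lt_comm₀ hun hr', ← one_div]; exact hR
  obtain ⟨h1, -⟩ := hbound τ hτmem hτH
  obtain ⟨-, -, hnorm⟩ := H_inv_eq φ (G := G) hτH
  rw [hτu] at hnorm
  rw [hnorm]
  simpa only [hτu] using h1

/-- **At a regular boundary point `H²` has a positive multiple of `κ²` as limit.** If the real point `x` is sent by
`P = Ψ ∘ cayley` into the open piece `j` (`P x = ℓ s`, `t j < s < t (j+1)`, `j < N`), then
`H(u)² → ρ · (d_0³/u_0²)²` as `u → x` within `ℍ`, for some real `ρ > 0`. -/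
theorem H_sq_tendsto_regular (D : DobrushinDomain) (N : ℕ) (ℓ : ℝ → ℂ) (t : ℕ → ℝ) (G : ℂ → ℂ) (d : ℕ → ℂ) (K : Set ℂ)
    (hN : 0 < N) (hper : ∀ s : ℝ, ℓ (s + 2 * Real.pi) = ℓ s) (hrange : Set.range ℓ = frontier D.carrier)
    (hinj : Set.InjOn ℓ (Set.Ico 0 (2 * Real.pi))) (ht0 : t 0 = 0) (htlt : ∀ j, t j < t (j + 1))
    (htper : ∀ j, t (j + N) = t j + 2 * Real.pi) (hseg : ∀ j, IsBdrySegment D (ℓ (t j)) (ℓ (t (j + 1))))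
    (haff : ∀ (j : ℕ) (s : ℝ), t j ≤ s → s ≤ t (j + 1) →
      ℓ s = ℓ (t j) + (((s - t j) / (t (j + 1) - t j) : ℝ) : ℂ) * (ℓ (t (j + 1)) - ℓ (t j)))
    (hd0 : ‖d 0‖ = 1)
    (hd : ∀ j, d (j + 1) = d j * Complex.exp ((((2 / 3 : ℝ) * ((ℓ (t (j + 2)) - ℓ (t (j + 1))) /
      (ℓ (t (j + 1)) - ℓ (t j))).arg + Real.pi / 3 * markInd D (ℓ (t (j + 1)))) : ℝ) * Complex.I))
    (hGc : ContinuousOn G (closure D.carrier)) (hGd : DifferentiableOn ℂ G D.carrier) (hGim : G '' D.carrier = interior K)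
    (hstrict : ∀ w₀ ∈ interior K, ∀ j : ℕ, 0 < ((w₀ - G (ℓ (t j))) * (starRingEnd ℂ) (d j)).im)
    (hmono : ∀ (j : ℕ) (s s' : ℝ), t j ≤ s → s ≤ s' → s' ≤ t (j + 1) → ∃ r : ℝ, 0 ≤ r ∧ G (ℓ s') - G (ℓ s) = r * d j)
    (φ : ConformalEquiv upperHalfPlaneSet D.carrier) (Ψ : ℂ → ℂ) (hΨc : ContinuousOn Ψ (closedBall 0 1))
    (hΨcl : MapsTo Ψ (closedBall 0 1) (closure D.carrier))
    (hΨfr : MapsTo Ψ (sphere 0 1) (frontier D.carrier)) (hφΨ : ∀ u ∈ upperHalfPlaneSet, φ u = Ψ (cayleyFun u))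
    (hΨ0 : Ψ (cayleyFun 0) = D.pt 0)
    (x : ℝ) (j : ℕ) (hj : j < N) (s : ℝ) (hs1 : t j < s) (hs2 : s < t (j + 1)) (hx : Ψ (cayleyFun x) = ℓ s) :
    ∃ ρ : ℝ, 0 < ρ ∧ Tendsto (fun u => (deriv G (φ u) ^ 3 * u * deriv φ u) ^ 2) (𝓝[upperHalfPlaneSet] x)
      (𝓝 ((ρ : ℂ) * (d 0 ^ 3 / ((ℓ (t 1) - ℓ (t 0)) / (‖ℓ (t 1) - ℓ (t 0)‖ : ℂ)) ^ 2) ^ 2)) := by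
  have hne : ∀ j, ℓ (t j) ≠ ℓ (t (j + 1)) := fun j => (hseg j).1
  have hd1 : ∀ j, ‖d j‖ = 1 := norm_dir_eq_one hd0 hd
  set uj : ℂ := (ℓ (t (j + 1)) - ℓ (t j)) / (‖ℓ (t (j + 1)) - ℓ (t j)‖ : ℂ) with huj
  have hujn : ‖uj‖ = 1 := norm_unitDir (hne j)
  have hujne : uj ≠ 0 := fun h => by rw [h, norm_zero] at hujn; exact zero_ne_one hujn
  have hdjne : d j ≠ 0 := fun h => by have := hd1 j; rw [h, norm_zero] at this; exact zero_ne_one this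
  -- `x ≠ 0`: the image of `x` lies in an open piece, `a = P 0` does not
  set P : ℂ → ℂ := fun u => Ψ (cayleyFun u) with hP
  have hPc : ContinuousOn P {u : ℂ | 0 ≤ u.im} := continuousOn_extP hΨc
  have hx0 : (x : ℂ) ≠ 0 := by
    intro h
    have h1 : ℓ s = D.pt 0 := by rw [← hx, h, hΨ0]
    exact (hseg j).2.2.1 (h1 ▸ mem_openSegment_of_mem_Ioo haff hs1 hs2)
  -- the neighbourhood of the piece and the radius
  obtain ⟨ρ₀, hρ₀, hnear⟩ := frontier_near_piece hN hper hrange hinj ht0 htlt htper haff hj hs1 hs2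
  obtain ⟨r, hr, hrad⟩ := exists_radius_of_continuousOn hPc (x₀ := (x : ℂ)) (by simp) hρ₀
  have himadd : ∀ z : ℂ, ((x : ℂ) + z).im = z.im := fun z => by simp
  have hseg_of_real : ∀ z ∈ ball (0:ℂ) r, z.im = 0 → P ((x : ℂ) + z) ∈ segment ℝ (ℓ (t j)) (ℓ (t (j + 1))) := by
    intro z hz hzim
    have hfr : P ((x : ℂ) + z) ∈ frontier D.carrier := hΨfr (cayleyFun_mem_sphere (by rw [himadd]; exact hzim))
    refine hnear _ hfr ?_
    rw [← hx]
    exact hrad _ (by rw [himadd]; exact hzim.ge) (by simpa [dist_eq_norm] using mem_ball_zero_iff.1 hz)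
  have hmemH : ∀ z : ℂ, 0 < z.im → (x : ℂ) + z ∈ upperHalfPlaneSet := fun z hz => by
    show 0 < ((x : ℂ) + z).im; rw [himadd]; exact hz
  -- the two straightened maps along the piece
  set fP : ℂ → ℂ := fun z => (P ((x : ℂ) + z) - ℓ (t j)) / uj with hfP
  set fG : ℂ → ℂ := fun z => (G (P ((x : ℂ) + z)) - G (ℓ (t j))) / d j with hfG
  have hPxc : ContinuousOn (fun z => P ((x : ℂ) + z)) (ball (0:ℂ) r ∩ {z : ℂ | 0 ≤ z.im}) :=
    hPc.comp (continuous_const_add _).continuousOn fun z hz => by simpa [himadd] using hz.2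
  have hφxd : DifferentiableOn ℂ (fun z => φ ((x : ℂ) + z)) (ball (0:ℂ) r ∩ {z : ℂ | 0 < z.im}) :=
    φ.differentiableOn.comp (differentiableOn_id.const_add _) fun z hz => hmemH z hz.2
  have hPφ : ∀ z ∈ ball (0:ℂ) r, 0 < z.im → P ((x : ℂ) + z) = φ ((x : ℂ) + z) :=
    fun z _ hzim => (hφΨ _ (hmemH z hzim)).symm
  have hfPc : ContinuousOn fP (ball (0:ℂ) r ∩ {z : ℂ | 0 ≤ z.im}) := (hPxc.sub continuousOn_const).div_const _
  have hfPd : DifferentiableOn ℂ fP (ball (0:ℂ) r ∩ {z : ℂ | 0 < z.im}) :=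
    ((hφxd.sub_const (ℓ (t j))).div_const uj).congr fun z hz => by simp only [hfP, hPφ z hz.1 hz.2]
  have hfPreal : ∀ z ∈ ball (0:ℂ) r, z.im = 0 → (fP z).im = 0 := by
    intro z hz hzim
    obtain ⟨μ, -, -, hμ⟩ := dom_piece_param hne j (hseg_of_real z hz hzim)
    simp only [hfP]; rw [hμ, ofReal_im]
  have hfPpos : ∀ z ∈ ball (0:ℂ) r, 0 < z.im → 0 < (fP z).im := by
    intro z hz hzim
    simp only [hfP, hPφ z hz hzim]
    exact im_dom_piece_pos hseg j (φ.mapsTo (hmemH z hzim))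
  have hGPxc : ContinuousOn (fun z => G (P ((x : ℂ) + z))) (ball (0:ℂ) r ∩ {z : ℂ | 0 ≤ z.im}) :=
    hGc.comp hPxc fun z hz => hΨcl (cayleyFun_mem_closedBall (by rw [himadd]; exact hz.2))
  have hGφxd : DifferentiableOn ℂ (fun z => G (φ ((x : ℂ) + z))) (ball (0:ℂ) r ∩ {z : ℂ | 0 < z.im}) :=
    hGd.comp hφxd fun z hz => φ.mapsTo (hmemH z hz.2)
  have hfGc : ContinuousOn fG (ball (0:ℂ) r ∩ {z : ℂ | 0 ≤ z.im}) := (hGPxc.sub continuousOn_const).div_const _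
  have hfGd : DifferentiableOn ℂ fG (ball (0:ℂ) r ∩ {z : ℂ | 0 < z.im}) :=
    ((hGφxd.sub_const (G (ℓ (t j)))).div_const (d j)).congr fun z hz => by simp only [hfG, hPφ z hz.1 hz.2]
  have hfGreal : ∀ z ∈ ball (0:ℂ) r, z.im = 0 → (fG z).im = 0 := by
    intro z hz hzim
    obtain ⟨μ, -, hμ⟩ := img_piece_param htlt haff hd1 hmono j (hseg_of_real z hz hzim)
    simp only [hfG]; rw [hμ, ofReal_im]
  have hfGpos : ∀ z ∈ ball (0:ℂ) r, 0 < z.im → 0 < (fG z).im := by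
    intro z hz hzim
    simp only [hfG, hPφ z hz hzim]
    have hint : G (φ ((x : ℂ) + z)) ∈ interior K := by rw [← hGim]; exact mem_image_of_mem G (φ.mapsTo (hmemH z hzim))
    exact im_img_piece_pos hd1 hstrict j hint
  obtain ⟨LP, hLP, -, hTP⟩ := reflectedGerm fP hr hfPc hfPd hfPreal hfPpos
  obtain ⟨LG, hLG, -, hTG⟩ := reflectedGerm fG hr hfGc hfGd hfGreal hfGpos
  -- transfer to the variable `u = x + ζ`
  have hT : Tendsto (fun u : ℂ => u - x) (𝓝[upperHalfPlaneSet] (x : ℂ)) (𝓝[{z : ℂ | 0 < z.im}] 0) := by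
    refine tendsto_nhdsWithin_iff.2 ⟨?_, ?_⟩
    · have : Tendsto (fun u : ℂ => u - x) (𝓝 (x : ℂ)) (𝓝 ((x : ℂ) - x)) := (continuous_id.sub continuous_const).tendsto _
      rw [sub_self] at this
      exact this.mono_left nhdsWithin_le_nhds
    · filter_upwards [self_mem_nhdsWithin] with u (hu : 0 < u.im)
      show 0 < (u - x).im
      simpa using hu
  have hev : ∀ᶠ u in 𝓝[upperHalfPlaneSet] (x : ℂ), u ∈ upperHalfPlaneSet ∧ u - x ∈ ball (0:ℂ) r := by
    filter_upwards [self_mem_nhdsWithin, hT (ball_inter_mem_nhdsWithin_pos hr)] with u hu hu'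
    exact ⟨hu, hu'.1⟩
  have hderP : ∀ u ∈ upperHalfPlaneSet, u - x ∈ ball (0:ℂ) r → deriv fP (u - x) = deriv φ u / uj := by
    intro u hu hur
    have him : 0 < (u - (x : ℂ)).im := by simpa using (show 0 < u.im from hu)
    rw [deriv_straighten (q := fun z => φ ((x : ℂ) + z)) (c := ℓ (t j)) (w := uj) hur him
      (fun z hz hzim => by simp only [hfP, hPφ z hz hzim]), deriv_comp_const_add, add_sub_cancel]
  have hderG : ∀ u ∈ upperHalfPlaneSet, u - x ∈ ball (0:ℂ) r →
      deriv fG (u - x) = deriv G (φ u) * deriv φ u / d j := by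
    intro u hu hur
    have him : 0 < (u - (x : ℂ)).im := by simpa using (show 0 < u.im from hu)
    rw [deriv_straighten (q := fun z => G (φ ((x : ℂ) + z))) (c := G (ℓ (t j))) (w := d j) hur him
      (fun z hz hzim => by simp only [hfG, hPφ z hz hzim])]
    rw [deriv_comp_const_add (fun v => G (φ v)) (x : ℂ) (u - x), add_sub_cancel, deriv_comp_uniformizer φ hGd hu]
  have h1 : Tendsto (fun u => deriv φ u) (𝓝[upperHalfPlaneSet] (x : ℂ)) (𝓝 ((LP : ℂ) * uj)) := by
    have := ((hTP.comp hT).mul_const uj).congr' (by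
      filter_upwards [hev] with u hu
      show deriv fP (u - x) * uj = deriv φ u
      rw [hderP u hu.1 hu.2, div_mul_cancel₀ _ hujne])
    exact this
  have h2 : Tendsto (fun u => deriv G (φ u) * deriv φ u) (𝓝[upperHalfPlaneSet] (x : ℂ)) (𝓝 ((LG : ℂ) * d j)) := by
    have := ((hTG.comp hT).mul_const (d j)).congr' (by
      filter_upwards [hev] with u hu
      show deriv fG (u - x) * d j = deriv G (φ u) * deriv φ u
      rw [hderG u hu.1 hu.2, div_mul_cancel₀ _ hdjne])
    exact this
  have hLPu : (LP : ℂ) * uj ≠ 0 := mul_ne_zero (by exact_mod_cast hLP.ne') hujne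
  have h3 : Tendsto (fun u => deriv G (φ u)) (𝓝[upperHalfPlaneSet] (x : ℂ)) (𝓝 ((LG : ℂ) * d j / ((LP : ℂ) * uj))) := by
    refine ((h2.div h1 hLPu)).congr' ?_
    filter_upwards [hev] with u hu
    exact mul_div_cancel_right₀ _ (deriv_symm_eq_inv φ hu.1).1
  have h4 : Tendsto (fun u : ℂ => u) (𝓝[upperHalfPlaneSet] (x : ℂ)) (𝓝 (x : ℂ)) :=
    tendsto_id.mono_left nhdsWithin_le_nhds
  have hH : Tendsto (fun u => (deriv G (φ u) ^ 3 * u * deriv φ u) ^ 2) (𝓝[upperHalfPlaneSet] (x : ℂ))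
      (𝓝 ((((LG : ℂ) * d j / ((LP : ℂ) * uj)) ^ 3 * x * ((LP : ℂ) * uj)) ^ 2)) :=
    (((h3.pow 3).mul h4).mul h1).pow 2
  -- identify the limit
  have hxr : x ≠ 0 := fun h => hx0 (by rw [h]; simp)
  refine ⟨(LG ^ 3 * x / LP ^ 2) ^ 2, by positivity, ?_⟩
  have hκ := kappa_sq_eq hne hd j
  convert hH using 2
  rw [← hκ, ← huj]
  have hLPc : (LP : ℂ) ≠ 0 := by exact_mod_cast hLP.ne'
  push_cast
  field_simp

end Summit.CriticalPhenomena.CardyFormulaZ2.Cruxes.ParafermionToSLESixFamilies.PotentialDarbouxPicardDiamond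

end
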